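import Summits.ResolutionOfSingularities.ResolutionOfSingularities.Theorems.WeightedInvariantWeightedThesisHypersurfaceChoiceDim
import HarnessLib

/-!
# The bottom rung of the ladder: transversal dimension `0` is vacuous

Route `ResolutionOfSingularities/WeightedInvariant`, crux `Theses.WeightedInvariant.WeightedThesis`
(stmt-ResolutionOfSingularities-0569), line `datum-glued-split`, lead c9, RESHAPE 9 — a sanity inhabitant of
the ladder `HypersurfaceCentreChoiceDim p e` (`Theorems/…HypersurfaceChoiceDim.lean`).

* `isRegular_of_topologicalKrullDim_eq_zero` — an integral scheme of dimension `0` is regular (it is one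
  point, whose local ring is the function field);
* `HypersurfacePair.isRegular_of_reachDim_zero` — a pair reached in transversal dimension `0` has a regular
  hypersurface (the start pair is regular, so no tower step leaves it);
* `hyp_nonempty_choiceDim_zero` (registered stub of the line) — **`HypersurfaceCentreChoiceDim p 0` is
  inhabited for every `p`** (by the unit Rees algebra: every obligation is guarded by non-regularity). So the
  ladder `(∀ e, Nonempty (HypersurfaceCentreChoiceDim p e))` starts; its first non-trivial rung `e = 1` is the
  sector of Abramovich–Quek–Schober, arXiv:2507.01232, Thm. 1.1.
-/

noncomputable section

open CategoryTheory AlgebraicGeometry TopologicalSpace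
open Literature.AlgebraicGeometry.Resolution

set_option linter.dupNamespace false -- mandated namespace of this single-conjunct summit

namespace Summit.ResolutionOfSingularities.ResolutionOfSingularities.Theorems

/-- **An integral scheme of dimension `0` is regular**: every point is the generic point (a proper
irreducible closed subset `closure {x} ⊊ X` would be a chain of length `1`), and the stalk at the generic
point of an integral scheme is its function field, a regular local ring. [folklore] -/
theorem isRegular_of_topologicalKrullDim_eq_zero {X : Scheme.{0}} [IsIntegral X]
    (h : topologicalKrullDim X = 0) : Scheme.IsRegular X := by
  intro x
  have hmax := Order.krullDim_nonpos_iff_forall_isMax.mp (le_of_eq h)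
  let Z₁ : IrreducibleCloseds X := ⟨closure {x}, isIrreducible_singleton.closure, isClosed_closure⟩
  let Z₂ : IrreducibleCloseds X := ⟨Set.univ, IrreducibleSpace.isIrreducible_univ X, isClosed_univ⟩
  have hle : Z₁ ≤ Z₂ := fun _ _ => Set.mem_univ _
  have hge : Z₂ ≤ Z₁ := hmax Z₁ hle
  have hx : IsGenericPoint x (⊤ : Set X) := by
    refine Set.Subset.antisymm (Set.subset_univ _) ?_
    intro y _
    exact hge (Set.mem_univ y)
  have hxg : x = genericPoint X := hx.eq (genericPoint_spec X)
  subst hxg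
  exact inferInstanceAs (IsRegularLocalRing X.functionField)

namespace HypersurfacePair

variable {k : Type} [Field k]
  {c : ∀ ⦃Y : Scheme.{0}⦄, (Y ⟶ Spec (.of k)) → Y.IdealSheafData → ReesAlgebraData Y}

/-- **A pair reached in transversal dimension `0` has a regular hypersurface**: the start pair has a
`0`-dimensional integral, hence regular, hypersurface, and a tower step requires a non-regular one, so the
tower never leaves the start. [folklore] -/
theorem isRegular_of_reachDim_zero {P : HypersurfacePair k} (h : ReachDim c 0 P) :
    Scheme.IsRegular P.X.subscheme := by
  obtain ⟨P₀, h0, hch⟩ := h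
  haveI := P₀.isIntegral
  have hreg₀ : Scheme.IsRegular P₀.X.subscheme :=
    isRegular_of_topologicalKrullDim_eq_zero (by exact_mod_cast h0)
  -- induction along the chain: every pair on it equals the (regular) start
  induction hch with
  | refl => exact hreg₀
  | tail _ hstep ih => exact absurd ih hstep.1

end HypersurfacePair

/-- **The bottom rung: `HypersurfaceCentreChoiceDim p 0` is inhabited** (registered stub of line
`datum-glued-split`, RESHAPE 9): take the unit Rees algebra as the centre everywhere; every obligation of a
choice in transversal dimension `0` is guarded by the non-regularity of a hypersurface reached in transversal
dimension `0`, which is regular (`HypersurfacePair.isRegular_of_reachDim_zero`), and the restricted tower-step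
relation is empty, hence well-founded. [folklore] -/
theorem hyp_nonempty_choiceDim_zero : ∀ p : ℕ, Nonempty (Summit.ResolutionOfSingularities.ResolutionOfSingularities.Theorems.HypersurfaceCentreChoiceDim p 0) := by
  intro p
  refine ⟨{
    centre := fun _ _ Y _ _ => ReesAlgebraData.unit Y
    isRegularWeightedCentre_centre := fun _ _ _ _ P hP hsing =>
      absurd (HypersurfacePair.isRegular_of_reachDim_zero hP) hsing
    genericPoint_not_mem_support_centre := fun _ _ _ _ _ _ f _ _ _ i _ _ hlp hP hsing => by
      have hreg := HypersurfacePair.isRegular_of_reachDim_zero hP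
      have hreg' : Scheme.IsRegular i.ker.subscheme := hreg
      exact absurd ((isRegular_iff_isRegular_image i).mpr hreg') hsing
    centre_isHomogeneous := fun _ _ _ _ P hP hsing =>
      absurd (HypersurfacePair.isRegular_of_reachDim_zero hP) hsing
    wellFounded_step := fun _ _ _ _ => ⟨fun P => ⟨P, fun P' h =>
      absurd (HypersurfacePair.isRegular_of_reachDim_zero h.1) h.2.1⟩⟩ }⟩

end Summit.ResolutionOfSingularities.ResolutionOfSingularities.Theorems

end
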